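import Summits.QuantumFields.YangMills.Theorems.BalabanUVNodesN12MinimiserFamilyOfClassGaugeRowUniform
import Summits.QuantumFields.YangMills.Theorems.BalabanUVNodesN12MinimiserFamilyOfClassThreshold

/-!
# DAG node N12 [B15] — εreg-UNIFORM EDITION OF «(J0′) OF RECORD»: the threshold `δ₀` is announced BEFORE the class tolerance; the tolerance `εr`, its floors (`12(d−1)L·εr ≤ ρ″`,
# `εr ≤ εH`) and the class facts follow under `∀ εr` at `ν⟨εreg := εr⟩`; per base field only (E) · datum regularity · (δ) (resp. (δ) for `U₀^σ`, `σ` residual) · (T1@q₀)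

[Balaban1989LargeFieldII] = «[LF-II]», p. 357, (1.7)–(1.9) p. 358, (1.12)–(1.13) p. 359; [Balaban1989LargeFieldI] = «[IV]», (1.74) p. 192, Prop. 1 p. 194; [Balaban1985Variational] = «[15]»,
(2)–(4) p. 278, Thm 1 p. 279, Sect. C (44)–(48) p. 285, (81)–(83) p. 290, (181) p. 307, Sect. G pp. 305–307; [Balaban1984PropagatorsII] = «[B6]», Lemma 2.4 (2.128) p. 245;
[Balaban1985Averaging] = «[4]», (122)–(126) p. 36; [Balaban1985BackgroundPropagators] = «[B9]», (3.7) p. 391, (3.79)–(3.81) p. 406; [Balaban1985RegularSpaces] (1.7), (1.9) p. 77;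
[Balaban1988Convergent] = «[III]», (1.3) p. 246, (2.2) p. 255, (2.10)–(2.13) pp. 256–257.

Cell `pub-ymgap`, HUMAN RULINGS D-0062 ∕ D-0149, lane owner `pub-ymgap-dag-n12-c` (g26, strategy s1).  Key K1⁹ `stmt-QuantumFields-27364`, `--kind proof --supports … --as helper`; count-neutral.
NEW leaf; CONSUMED BY NAME, nothing modified: V3u (`…GaugeRowUniform`), dag-n12-w6's (M)-row producer `…N12MultiplierLetterOfClass` and [15] (45) `N12HVelocityOfClass.hH_velocity_Bj_of_isMinimizer_class`
(both stated for EVERY `ν`), the lane's (R2) inhabitant `…N12SliceDatumCurvatureOfClass` (one `M₂` per height — made `εreg`-uniform in §1 by class monotonicity in the tolerance), V4's §1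
`thm1Row_gaugeAct_of_residual`, `B15Prop1MinimiserTowerAxialGauge.isMinimizer_gaugeAct_of_residual`.

WHY (lane self-report «LOCATED-δ₀ν», pub-ymgap INBOX 2026-08-29T14:02Z).  V4 (`…Threshold`, p722394) announces `∃ δ₀ > 0` AFTER `ν : Stage7Numerics`, hence formally after the class
tolerance `ν.εreg`, although `δ₀ = min r (min 1 (c♭ ∕ (2(K+1))))` is built from `εreg`-free data (`c♭, C, r` of (P♭Q)∕(L), `M₂` of the closed plaquette-small set `T(ρ″)`, `B₁ = √2(1+2·#bonds·Lp)√#bonds·B`).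
A consumer at the record must take the tolerance small against `δ₀` (directly, or through the (σ)_N tolerance of `…DatumLetters`), which the V4 binder order does not allow honestly.
THIS FILE: §1 the (2.12) class is MONOTONE in its tolerance (`regMSCoPOfRecord_mono_eps`) and hence the (R2) constant serves every tolerance below the floor's cap `ρ″∕(12(d−1)L)`
(`exists_uniform_sliceDatum_curvatureLetter_of_class_uniform`); §2 V4u = V4 §2 with `δ₀` FIRST and `∀ εr` after (proof = V4's, over V3u and §1); §3 the residual-gauge form.

CONTENTS (namespace `Summit.QuantumFields.YangMills.BalabanUVNodes.N12MinimiserFamilyOfClassThresholdUniform`; theorems only, no `def`, no `instance`, no `sorry`).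
§1 `regMSCoPOfRecord_mono_eps`, ★★ `exists_uniform_sliceDatum_curvatureLetter_of_class_uniform`; §2 ★★★ `hMin_atRecord_of_node00Letters_thm1AtBase_central_ofClass_threshold_uniform`;
§3 ★★★ `hMin_atRecord_of_node00Letters_thm1AtBase_central_ofClass_threshold_residual_uniform`.

HONEST FRAMING ∕ LOCATED.  Binder re-ordering + one monotonicity remark; (E) and (T1@q₀) remain [15] Thm 1's rows; (δ) a GAUGE letter (LOCATED-GEOM v3 scope); `δ₀` EXISTENTIAL per (instance,
height), now CERTIFIED independent of the class tolerance (still U4: NOT print's volume-uniform constant; k-uniformity NOT claimed); nothing of Bałaban's estimates asserted; count-neutral helper;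
N12 NOT discharged; K1⁹ NOT closed; counts unmoved; one finite 𝕋⁴ programme at fixed ε — R4 closes the conditional finite-𝕋⁴ rung `BalabanLadder.UV` only; NOT continuum ∕ OS ∕ mass gap ∕ Clay.
-/

noncomputable section

open scoped BigOperators Matrix.Norms.L2Operator Topology

namespace Summit.QuantumFields.YangMills.BalabanUVNodes.N12MinimiserFamilyOfClassThresholdUniform

open Set Metric Filter
open Literature.MathematicalPhysics.QuantumFieldTheory.Balaban1983to89
open Literature.MathematicalPhysics.QuantumFieldTheory.Balaban1983to89.Node00 (SU coeField coeField_apply SmallBelow ConstrSet constrCard constrEnum dIterL)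
open T4Continuum B15DeterminingSets GaugeField
open B14.Eq213MaximalDomains (side)
open B14.Eq213DetSet (Bj Bj_of_gt Bj_zero maxDomT)
open B15Prop1Carrier (plaqsInside)
open B15AveragingHolomorphic (iterMh)
open B15ComplexifiedDatumFamily (conjVec)
open B15SU2ChartHolomorphic (genE expMulC logCoordC)
open B15Prop1AnalyticExtClause (cplxVec norm_cplxVec_apply)
open B15Prop1ChartCalculusSU2 (E3)
open B15Prop1ChartSU2 (su2Chart)
open B15ShellGauge193 (shellGauge)
open B15Extension193 (extend)
open B16Sect1Backgrounds (toMS expMul)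
open ExpMeanLog (expMeanLogSU)
open BlockAveraging (blockAvg)
open T4CubeChartGnomonic (SU2)
open Literature.MathematicalPhysics.QuantumFieldTheory.BalabanImbrieJaffe1984to88.BIJ85Eq453GaugeField (qsstarGIter0)
open Summit.QuantumFields.YangMills.BalabanUVNodes.N12MinimiserFamilyOfClassGaugeRowUniform (hMin_atRecord_of_node00Letters_thm1AtBase_central_ofClass_gaugeRow_uniform)
open Summit.QuantumFields.YangMills.BalabanUVNodes.N12MultiplierLetterOfClass (multiplierLetter_Bj_of_isMinimizer_class_of_curvatureLetter)
open Summit.QuantumFields.YangMills.BalabanUVNodes.N12HVelocityOfClass (hH_velocity_Bj_of_isMinimizer_class)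
open B15Prop1MinimiserTowerAxialGauge (isMinimizer_gaugeAct_of_residual)
open B15Eq177ValueInvarianceCoDiv (gaugeAct_mem_regMSCoPOfRecord)
open B16Sect1Backgrounds (mulG gaugeAct_gaugeAct)
open B14Eq16FaddeevPopov (wilsonAction4_gaugeAct')
open Summit.QuantumFields.YangMills.BalabanUVNodes.N12SliceDatumCurvatureOfClass (exists_uniform_sliceDatum_curvatureLetter_of_class)
open Summit.QuantumFields.YangMills.BalabanUVNodes.N12MinimiserFamilyOfClassThreshold (thm1Row_gaugeAct_of_residual)
open B5Eq118OneStroke (iterBlockOf)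
open B14.Eq216Concrete (feeds)
open B15Eq112TorusCover (lift)
open T4AxialGaugeSmallField (boxPlaqs)
open T4AdjointCovarianceUnitary (lieSU)
open Node00 (msChart avOfRecord regMSCoPOfRecord)
open scoped Matrix.Norms.L2Operator

variable {F : T4Family} {k : ℕ}

/-! ## §1  The class is monotone in its tolerance; the (R2) constant serves every tolerance below the cap -/

/-- **THE (2.12) CLASS GROWS WITH ITS TOLERANCE**: `U_k({Ω_j}, εr) ⊆ U_k({Ω_j}, εs)` for `εr ≤ εs` (both halves (1.7), (1.9) are strict inequalities against `ε·η_j²`, `ε·η_j³`; the support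
`Ω₀ = hullD M₁ 1 Ω₁` does not read the tolerance). [cite: Balaban1985Variational, (2) p.278; Balaban1985RegularSpaces, (1.7), (1.9) p.77] -/
theorem regMSCoPOfRecord_mono_eps (ν : Node00.Stage7Numerics) (Kt k : ℕ) (Ω : ℕ → Set (Site (F.P Kt) 0)) {εr εs : ℝ} (h : εr ≤ εs) :
    Node00.regMSCoPOfRecord F 2 {ν with εreg := εr} Kt k Ω ⊆ Node00.regMSCoPOfRecord F 2 {ν with εreg := εs} Kt k Ω := by
  intro U hU
  have hU' := (Node00.mem_regMSCoPOfRecordAt_iff F 2 {ν with εreg := εr} Kt k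
    (Node00.suppDomOfRecord F {ν with εreg := εr} Kt Ω) Ω U).1 hU
  have hη : ∀ j, 0 ≤ (F.P Kt).eta j := fun j => by unfold Params.eta; positivity
  refine (Node00.mem_regMSCoPOfRecordAt_iff F 2 {ν with εreg := εs} Kt k (Node00.suppDomOfRecord F {ν with εreg := εs} Kt Ω) Ω U).2 ⟨?_, ?_⟩
  · intro j hj p hp
    exact (hU'.1 j hj p hp).trans_le (mul_le_mul_of_nonneg_right h (pow_nonneg (hη j) 2))
  · intro j hj
    exact (hU'.2 j hj).of_le (mul_le_mul_of_nonneg_right h (pow_nonneg (hη j) 3))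

/-- ★★ **THE (R2) CONSTANT, UNIFORM IN THE CLASS TOLERANCE**: one `M₂ ≥ 0` per (instance, height) — announced BEFORE the tolerance — serving dag-n12-w6's `hcurv` for every configuration of
`U_k({Ω_j(Z)}, εr)` for EVERY `εr ≥ 0` with `12(d−1)L·εr ≤ ρ″` (`…N12SliceDatumCurvatureOfClass.exists_uniform_sliceDatum_curvatureLetter_of_class` at the cap `εreg := ρ″∕(12(d−1)L)` and
`regMSCoPOfRecord_mono_eps`). [cite: Balaban1985Variational, Sect. C (44)–(48) p.285, (81)–(83) p.290; Balaban1989LargeFieldII, (1.12)–(1.13) p.359; Balaban1988Convergent, (2.10)–(2.13) pp.256–257] -/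
theorem exists_uniform_sliceDatum_curvatureLetter_of_class_uniform (ν : Node00.Stage7Numerics) (Kt : ℕ) (hd : 2 ≤ (F.P Kt).d) (Z : Set (Site (F.P Kt) 0))
    (hkK : k + 1 ≤ (F.P Kt).m + (F.P Kt).K) (hM4 : 4 * (F.P Kt).L ≤ ν.M₁) (hdiv : side (F.P Kt).L ν.M₁ k ∣ (F.P Kt).sitesPerDir 0)
    {ρ'' : ℝ} (hρ : 0 < ρ'') (hsbU : ∀ V : GaugeField (F.P Kt) 0 SU2, ‖coeField V - 1‖ ≤ ρ'' → SmallBelow (Node00.avOfRecord F 2 Kt) k V) :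
    ∃ M₂ : ℝ, 0 ≤ M₂ ∧ ∀ (εr : ℝ), 0 ≤ εr → 12 * ((((F.P Kt).d - 1 : ℕ)) : ℝ) * (F.P Kt).L * εr ≤ ρ'' →
      ∀ U₀ ∈ Node00.regMSCoPOfRecord F 2 {ν with εreg := εr} Kt k (maxDomT ν.M₁ Z), ∀ W : MSField (F.P Kt) SU2,
      AgreeOn (Bj ν.M₁ Z k) (avgFamily (Node00.avOfRecord F 2 Kt) U₀) W →
      ∀ (S : Submodule ℂ (VecField (F.P Kt) 0 (EuclideanSpace ℂ (Fin 3)))) (Φ₀ : S → Fin (constrCard (Bj ν.M₁ Z k) k) → EuclideanSpace ℂ (Fin 3)),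
        (∀ (X : S) i, Φ₀ X i = logCoordC (star ((W ((constrEnum (Bj ν.M₁ Z k) k).symm i).1 ((constrEnum (Bj ν.M₁ Z k) k).symm i).2.1 : SU2) : Matrix (Fin 2) (Fin 2) ℂ) *
          iterMh ((constrEnum (Bj ν.M₁ Z k) k).symm i).1 (expMulC (X : VecField (F.P Kt) 0 (EuclideanSpace ℂ (Fin 3))) (coeField U₀)) ((constrEnum (Bj ν.M₁ Z k) k).symm i).2.1)) →
        ∀ (p : VecField (F.P Kt) 0 E3) (hp : cplxVec p ∈ S), fderiv ℂ Φ₀ 0 ⟨cplxVec p, hp⟩ = 0 →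
          ‖fderiv ℂ (fderiv ℂ Φ₀) 0 ⟨cplxVec p, hp⟩ ⟨cplxVec p, hp⟩‖ ≤ M₂ * ∑ b : PBond (F.P Kt) 0, ‖p b‖ ^ 2 := by
  -- the cap of the floor
  have hcpos : (0 : ℝ) < 12 * ((((F.P Kt).d - 1 : ℕ)) : ℝ) * (F.P Kt).L := by
    have h1 : (1 : ℝ) ≤ ((((F.P Kt).d - 1 : ℕ)) : ℝ) := by exact_mod_cast (show 1 ≤ (F.P Kt).d - 1 by omega)
    have h2 : (1 : ℝ) ≤ ((F.P Kt).L : ℝ) := by exact_mod_cast (F.P Kt).L_pos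
    nlinarith
  obtain ⟨εs, hεs⟩ : ∃ εs : ℝ, εs = ρ'' / (12 * ((((F.P Kt).d - 1 : ℕ)) : ℝ) * (F.P Kt).L) := ⟨_, rfl⟩
  have hεs0 : 0 ≤ εs := by rw [hεs]; positivity
  have hεsρ : 12 * ((((F.P Kt).d - 1 : ℕ)) : ℝ) * (F.P Kt).L * εs ≤ ρ'' := by
    rw [hεs, mul_div_cancel₀ _ hcpos.ne']
  obtain ⟨M₂, hM₂, hR2⟩ := exists_uniform_sliceDatum_curvatureLetter_of_class {ν with εreg := εs} Kt hd Z hkK hM4 hdiv hεs0 hρ hsbU hεsρ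
  refine ⟨M₂, hM₂, fun εr hεr hεrρ U₀ hU₀ => hR2 U₀ (regMSCoPOfRecord_mono_eps ν Kt k (maxDomT ν.M₁ Z) ?_ hU₀)⟩
  rw [hεs, le_div_iff₀ hcpos]
  linarith

/-! ## §2  V4u — the threshold before the class tolerance -/

/-- ★★★ **V4u — «(J0′) OF RECORD» WITH THE THRESHOLD ANNOUNCED BEFORE THE CLASS TOLERANCE.**  As `…N12MinimiserFamilyOfClassThreshold` §2 (p722394) VERBATIM, except: `0 ≤ ν.εreg`, the
floor `12(d−1)L·εreg ≤ ρ″`, `εreg ≤ εH` and the class facts `reg' hreg' hcl hDreg'` move AFTER `∃ δ₀ > 0`, under `∀ εr : ℝ`, and the class reads `regMSCoPOfRecord F 2 {ν with εreg := εr} …`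
everywhere; the window `Λ lo hi`, the datum tolerance `δ`, the extension `ext`, the compact parameter set `K` and the bound `𝓐₀` also move after `∃ δ₀` (the threshold depends on
`(Kt, k, Z, ν.M₁, ρ″, B, forest)` only).  Proof = V4's, over V3u (`…_gaugeRow_uniform`), §1's uniform (R2) constant, dag-n12-w6's producers at `ν⟨εreg := εr⟩`.
[cite: Balaban1989LargeFieldII, p.357, (1.7)–(1.9) p.358, (1.12)–(1.13) p.359; Balaban1989LargeFieldI, (1.74) p.192, Prop. 1 p.194; Balaban1985Variational, Thm 1 p.279, Sect. C (44)–(48) p.285, (81)–(83) p.290, Sect. G pp.305–307; Balaban1984PropagatorsII, Lemma 2.4 (2.128) p.245; Balaban1985Averaging, (122)–(126) p.36; Balaban1985BackgroundPropagators, (3.7) p.391, (3.79)–(3.81) p.406; Balaban1988Convergent, (1.3) p.246, (2.2) p.255, (2.10)–(2.13) pp.256–257] -/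
theorem hMin_atRecord_of_node00Letters_thm1AtBase_central_ofClass_threshold_uniform (ν : Node00.Stage7Numerics) (Kt : ℕ) (hd : 2 ≤ (F.P Kt).d) (Z : Set (Site (F.P Kt) 0)) (𝔹 : DetSet (F.P Kt)) (h𝔹Z : 𝔹 = Bj ν.M₁ Z k) (hkK : k + 1 ≤ (F.P Kt).m + (F.P Kt).K)
    (hM4 : 4 * (F.P Kt).L ≤ ν.M₁) (hdiv : side (F.P Kt).L ν.M₁ k ∣ (F.P Kt).sitesPerDir 0) (hZblk : B14.Eq22Determines.IsBlockUnion k Z)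
    {ρ'' : ℝ} (hsbU : ∀ W : GaugeField (F.P Kt) 0 SU2, ‖coeField W - 1‖ ≤ ρ'' → SmallBelow (Node00.avOfRecord F 2 Kt) k W)
    (hρ : 0 < ρ'')
    (hk0 : 0 < k)
    -- ONCE per height: the right-inverse letter of the real chart (dag-n12-w6's `hHB`, inhabited by `N12HsurjOfClass.exists_hsurjLetters`)
    {εH B : ℝ}
    (hHB : ∀ (Wd : MSField (F.P Kt) SU2) (U₀ : GaugeField (F.P Kt) 0 SU2),
      AgreeOn (Bj ν.M₁ Z k) (avgFamily (avOfRecord F 2 Kt) U₀) Wd →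
      (∀ i' : Fin (constrCard (Bj ν.M₁ Z k) k), ∃ U' : GaugeField (F.P Kt) 0 SU2,
        (∀ b ∈ feeds (((constrEnum (Bj ν.M₁ Z k) k).symm i').1 : ℕ) ((constrEnum (Bj ν.M₁ Z k) k).symm i').2.1, U' b = U₀ b) ∧
          SmallBelow (avOfRecord F 2 Kt) k U') →
      (∀ (j : ℕ), 1 ≤ j → j ≤ k → ∀ y : Site (F.P Kt) j, embIter j y ∈ maxDomT ν.M₁ Z j → ∃ U' : GaugeField (F.P Kt) 0 SU2,
        (∀ c : PBond (F.P Kt) j, (c.src = y ∨ c.tgt = y) → ∀ b₀ : PBond (F.P Kt) 0,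
          (iterBlockOf j b₀.src = c.src ∨ iterBlockOf j b₀.src = c.tgt) → (iterBlockOf j b₀.tgt = c.src ∨ iterBlockOf j b₀.tgt = c.tgt) → U' b₀ = U₀ b₀) ∧
        SmallBelow (avOfRecord F 2 Kt) k U') →
      (∀ (j : ℕ), 1 ≤ j → j ≤ k → ∀ y : Site (F.P Kt) j, embIter j y ∈ maxDomT ν.M₁ Z j →
        PlaqSmallOn (boxPlaqs (fun κ => lift (F.P Kt) (embIter j y) κ - ((((F.P Kt).L ^ j : ℕ) : ℤ) + ((((F.P Kt).L ^ j - 1) / 2 : ℕ) : ℤ)))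
          (fun κ => lift (F.P Kt) (embIter j y) κ + ((((F.P Kt).L ^ j : ℕ) : ℤ) + ((((F.P Kt).L ^ j - 1) / 2 : ℕ) : ℤ))) : Set (Plaq (F.P Kt) 0)) εH U₀) →
      ∃ H : (Fin (constrCard (Bj ν.M₁ Z k) k) → lieSU (Fin 2)) → PBond (F.P Kt) 0 → lieSU (Fin 2),
        (∀ v, fderiv ℝ (msChart F 2 Kt k (Bj ν.M₁ Z k) Wd U₀) 0 (H v) = v) ∧ ∀ v, Real.sqrt (∑ b, ‖H v b‖ ^ 2) ≤ B * ‖v‖) (hB0 : 0 ≤ B)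
    -- ONE forest and its axial slice per instance (dag-n12-w3's `N12ForestSlice.exists_forest_slice_Bj`): (F1), (F2), (TREE), (F3)
    (path : Site (F.P Kt) 0 → List (LStep (F.P Kt) 0)) (S : Submodule ℂ (VecField (F.P Kt) 0 (EuclideanSpace ℂ (Fin 3))))
    (hF1 : ∀ x, ∀ s ∈ path x, ∃ x' x'' : Site (F.P Kt) 0, path x'' = path x' ++ [s] ∧
        (s.fwd = true → s.bond.src = x' ∧ s.bond.tgt = x'') ∧ (s.fwd = false → s.bond.src = x'' ∧ s.bond.tgt = x'))
    (hF2 : ∀ j, j ≤ k → ∀ c ∈ bondsOf (𝔹 j), path (embIter j c.src) = [] ∧ path (embIter j c.tgt) = [])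
    (hTREE : ∀ x : Site (F.P Kt) 0, x ∉ {z : Site (F.P Kt) 0 | ∃ j, j ≤ k ∧ ∃ c ∈ bondsOf (𝔹 j), (z = embIter j c.src ∨ z = embIter j c.tgt)} →
      ∃ (x' : Site (F.P Kt) 0) (s : LStep (F.P Kt) 0), path x = path x' ++ [s] ∧
        (s.fwd = true → s.bond.src = x' ∧ s.bond.tgt = x) ∧ (s.fwd = false → s.bond.src = x ∧ s.bond.tgt = x'))
    (hF3 : ∀ X : VecField (F.P Kt) 0 (EuclideanSpace ℂ (Fin 3)), X ∈ S ↔ ∀ x, ∀ s ∈ path x, X s.bond = 0) :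
    -- THE GAUGE-TOLERANCE THRESHOLD, announced before the base fields (it absorbs the flat coercivity `c♭` of (P♭Q), the (L) constant and radius, the preimage letter `B₁` and the chart curvature `M₂`)
    ∃ δ₀ : ℝ, 0 < δ₀ ∧
    -- THE WINDOW, THE DATUM's REGULARITY TOLERANCE, THE EXTENSION, THE COMPACT PARAMETER SET AND THE BOUND — ALL AFTER THE CONSTANTS
    ∀ (Λ : Set (Site (F.P Kt) k)) (lo hi : Fin (F.P Kt).d → ℤ) {δ : ℝ}, 0 < δ → 6 * ((((F.P Kt).d - 1 : ℕ)) : ℝ) * (F.P Kt).L ^ k * δ ≤ ρ'' →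
    ∀ (ext : GaugeField (F.P Kt) k SU2 → GaugeField (F.P Kt) k SU2), (∀ W, ext W = extend Λ (shellGauge W lo hi) W) →
    ∀ {K : Set (GaugeField (F.P Kt) k SU2)}, IsCompact K → ∀ {𝓐₀ : ℝ}, 1 < 𝓐₀ →
    -- THE CLASS TOLERANCE, ITS FLOORS AND THE CLASS FACTS, AFTER THE THRESHOLD (εreg-uniform edition: `ν⟨εreg := εr⟩`, `M₁` unchanged)
    ∀ (εr : ℝ), 0 ≤ εr → 12 * ((((F.P Kt).d - 1 : ℕ)) : ℝ) * (F.P Kt).L * εr ≤ ρ'' → εr ≤ εH →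
    ∀ (reg' : Set (GaugeField (F.P Kt) 0 SU2)), IsClosed reg' → closure (Node00.regMSCoPOfRecord F 2 {ν with εreg := εr} Kt k (maxDomT ν.M₁ Z)) ⊆ reg' →
      ContinuousOn (fun (U : GaugeField (F.P Kt) 0 SU2) (i : Fin (constrCard 𝔹 k)) =>
        ((avgFamily (Node00.avOfRecord F 2 Kt) U ((constrEnum 𝔹 k).symm i).1 ((constrEnum 𝔹 k).symm i).2.1 : SU2) : Matrix (Fin 2) (Fin 2) ℂ)) reg' →
    ∀ {δc : ℝ}, 0 ≤ δc → δc ≤ δ₀ →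
    (∀ Vk ∈ K, ∃ U₀ : GaugeField (F.P Kt) 0 SU2,
      IsMinimizer (Node00.avOfRecord F 2 Kt) (Node00.regMSCoPOfRecord F 2 {ν with εreg := εr} Kt k (maxDomT ν.M₁ Z)) 𝔹
        (avgFamily (Node00.avOfRecord F 2 Kt) (qsstarGIter0 k (ext Vk))) U₀ ∧
      PlaqSmallOn (plaqsInside (pts k Z)) δ (ext Vk) ∧
      -- (δ) DISPLAYED — THE ONE GAUGE letter (the direct road's (N)-package clause): `U₀` bondwise `δc`-flat on the plaquettes meeting a bond sourced in `Ω₁(Z)`; the tower-flatness row (δ_T) and the multiplier row (M) of p717767 FOLLOW (`B15Prop1TowerFlatOfNearFlat`; dag-n12-w6's `…N12MultiplierLetterOfClass` + the lane's `…N12SliceDatumCurvatureOfClass`)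
      (∀ q : Plaq (F.P Kt) 0, ((⟨q.src, q.μ⟩ : PBond (F.P Kt) 0) ∈ {b : PBond (F.P Kt) 0 | b.src ∈ maxDomT ν.M₁ Z 1} ∨
          (⟨q.src.shift q.μ, q.ν⟩ : PBond (F.P Kt) 0) ∈ {b : PBond (F.P Kt) 0 | b.src ∈ maxDomT ν.M₁ Z 1} ∨
          (⟨q.src.shift q.ν, q.μ⟩ : PBond (F.P Kt) 0) ∈ {b : PBond (F.P Kt) 0 | b.src ∈ maxDomT ν.M₁ Z 1} ∨
          (⟨q.src, q.ν⟩ : PBond (F.P Kt) 0) ∈ {b : PBond (F.P Kt) 0 | b.src ∈ maxDomT ν.M₁ Z 1}) →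
        ‖((U₀ ⟨q.src, q.μ⟩ : SU2) : Matrix (Fin 2) (Fin 2) ℂ) - 1‖ ≤ δc ∧ ‖((U₀ ⟨q.src.shift q.μ, q.ν⟩ : SU2) : Matrix (Fin 2) (Fin 2) ℂ) - 1‖ ≤ δc ∧
          ‖((U₀ ⟨q.src.shift q.ν, q.μ⟩ : SU2) : Matrix (Fin 2) (Fin 2) ℂ) - 1‖ ≤ δc ∧ ‖((U₀ ⟨q.src, q.ν⟩ : SU2) : Matrix (Fin 2) (Fin 2) ℂ) - 1‖ ≤ δc) ∧
      -- (T1@q₀) — the capstone's row verbatim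
      (∀ U ∈ reg', AgreeOn 𝔹 (avgFamily (Node00.avOfRecord F 2 Kt) U) (avgFamily (Node00.avOfRecord F 2 Kt) (qsstarGIter0 k (ext Vk))) →
        wilsonAction4 U ≤ wilsonAction4 U₀ →
          ∃ u : GaugeTransf (F.P Kt) 0 SU2, (∀ j, j ≤ k → ∀ b ∈ bondsOf (𝔹 j), toMS u j b.src = toMS u j b.tgt ∧ ∀ g : SU2, toMS u j b.src * g = g * toMS u j b.src) ∧ gaugeAct u U = U₀)) →
    ∃ R : ℝ, 0 < R ∧ ∀ Vk ∈ K,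
      ∃ Ũ : VecField (F.P Kt) k (EuclideanSpace ℂ (Fin 3)) × VecField (F.P Kt) k (EuclideanSpace ℂ (Fin 3)) → PBond (F.P Kt) 0 → Matrix (Fin 2) (Fin 2) ℂ,
        (∀ b i j, DifferentiableOn ℂ (fun z => Ũ z b i j) (ball 0 R)) ∧
        (∀ z ∈ ball (0 : VecField (F.P Kt) k (EuclideanSpace ℂ (Fin 3)) × VecField (F.P Kt) k (EuclideanSpace ℂ (Fin 3))) R, ∀ b i j, ‖Ũ z b i j‖ ≤ 𝓐₀) ∧
        ∀ p B' : VecField (F.P Kt) k E3, ‖p‖ < R → ‖B'‖ < R → ∃ U' : GaugeField (F.P Kt) 0 SU2,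
          (∀ b, Ũ (cplxVec p, cplxVec B') b = ((U' b : SU2) : Matrix (Fin 2) (Fin 2) ℂ)) ∧
            IsMinimizer (Node00.avOfRecord F 2 Kt) (Node00.regMSCoPOfRecord F 2 {ν with εreg := εr} Kt k (maxDomT ν.M₁ Z)) 𝔹
              (avgFamily (Node00.avOfRecord F 2 Kt) (qsstarGIter0 k (expMul su2Chart B' (ext (expMul su2Chart p Vk))))) U' := by
  subst h𝔹Z
  have hk : k ≤ (F.P Kt).m + (F.P Kt).K := Nat.le_of_succ_le hkK
  have hM : 1 ≤ ν.M₁ := le_trans (le_trans (F.P Kt).L_pos (by omega)) hM4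
  have hd1 : (0 : ℝ) ≤ ((((F.P Kt).d - 1 : ℕ)) : ℝ) := Nat.cast_nonneg _
  -- V3's constants, the chart-curvature constant of the height, the forest path-length bound
  obtain ⟨cflat, C, r, hcflat, hC, hr, hV3⟩ := hMin_atRecord_of_node00Letters_thm1AtBase_central_ofClass_gaugeRow_uniform ν Kt hd Z (Bj ν.M₁ Z k) rfl hkK hM4 hdiv hZblk
    hsbU hk0 path S hF1 hF2 hTREE hF3
  obtain ⟨M₂, hM₂, hR2⟩ := exists_uniform_sliceDatum_curvatureLetter_of_class_uniform ν Kt hd Z hkK hM4 hdiv hρ hsbU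
  obtain ⟨Lp, hlen⟩ : ∃ Lp : ℕ, ∀ x, (path x).length ≤ Lp :=
    ⟨Finset.univ.sup fun x => (path x).length, fun x => Finset.le_sup (f := fun x => (path x).length) (Finset.mem_univ x)⟩
  have hroot : ∀ r ∈ {z : Site (F.P Kt) 0 | ∃ j, j ≤ k ∧ ∃ c ∈ bondsOf ((Bj ν.M₁ Z k : DetSet (F.P Kt)) j), (z = embIter j c.src ∨ z = embIter j c.tgt)}, path r = [] := by
    rintro r ⟨j, hj, c, hc, hrc⟩
    rcases hrc with rfl | rfl
    exacts [(hF2 j hj c hc).1, (hF2 j hj c hc).2]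
  -- the threshold
  obtain ⟨B₁, hB₁⟩ : ∃ B₁ : ℝ, B₁ = Real.sqrt 2 * ((1 + 2 * (Fintype.card (PBond (F.P Kt) 0)) * Lp) * Real.sqrt (Fintype.card (PBond (F.P Kt) 0)) * B) := ⟨_, rfl⟩
  have hB₁0 : 0 ≤ B₁ := by rw [hB₁]; positivity
  obtain ⟨Kc, hKc⟩ : ∃ Kc : ℝ, Kc = 64 * (((F.P Kt).d : ℝ) - 1) + 8 * (((F.P Kt).d : ℝ) - 1) * B₁ * M₂ + (constrCard (Bj ν.M₁ Z k) k : ℝ) * C ^ 2 := ⟨_, rfl⟩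
  have hdR : (0 : ℝ) ≤ ((F.P Kt).d : ℝ) - 1 := by
    have : (1 : ℝ) ≤ ((F.P Kt).d : ℝ) := by exact_mod_cast (le_trans (by norm_num) hd)
    linarith
  have hKc0 : 0 ≤ Kc := by rw [hKc]; positivity
  refine ⟨min r (min 1 (cflat / (2 * (Kc + 1)))), lt_min hr (lt_min one_pos (by positivity)),
    fun Λ lo hi {δ} hδ hδρ ext hext {K} hK {𝓐₀} h𝓐₀ εr hε hερ hεH reg' hreg' hcl hDreg' {δc} hδc0 hδcδ hbase => ?_⟩
  have hερ6 : 6 * ((((F.P Kt).d - 1 : ℕ)) : ℝ) * (F.P Kt).L * εr ≤ ρ'' := by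
    have h : 0 ≤ ((((F.P Kt).d - 1 : ℕ)) : ℝ) * (F.P Kt).L * εr := by positivity
    linarith
  have hδcr : δc ≤ r := hδcδ.trans (min_le_left _ _)
  have hδc1 : δc ≤ 1 := hδcδ.trans ((min_le_right _ _).trans (min_le_left _ _))
  have hδcK : δc ≤ cflat / (2 * (Kc + 1)) := hδcδ.trans ((min_le_right _ _).trans (min_le_right _ _))
  -- the numerics of V3 at `m := 8(d−1)·δc·B₁·M₂`
  have hnum : 64 * (((F.P Kt).d : ℝ) - 1) * δc + 8 * (((F.P Kt).d : ℝ) - 1) * δc * B₁ * M₂ + (constrCard (Bj ν.M₁ Z k) k : ℝ) * C ^ 2 * δc ^ 2 < cflat := by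
    have hsq : δc ^ 2 ≤ δc := by nlinarith
    have h3 : (constrCard (Bj ν.M₁ Z k) k : ℝ) * C ^ 2 * δc ^ 2 ≤ (constrCard (Bj ν.M₁ Z k) k : ℝ) * C ^ 2 * δc :=
      mul_le_mul_of_nonneg_left hsq (by positivity)
    have h1 : 64 * (((F.P Kt).d : ℝ) - 1) * δc + 8 * (((F.P Kt).d : ℝ) - 1) * δc * B₁ * M₂ + (constrCard (Bj ν.M₁ Z k) k : ℝ) * C ^ 2 * δc ^ 2 ≤ Kc * δc := by
      have he : Kc * δc = 64 * (((F.P Kt).d : ℝ) - 1) * δc + 8 * (((F.P Kt).d : ℝ) - 1) * δc * B₁ * M₂ + (constrCard (Bj ν.M₁ Z k) k : ℝ) * C ^ 2 * δc := by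
        rw [hKc]; ring
      rw [he]
      linarith
    have h2 : Kc * δc ≤ Kc * (cflat / (2 * (Kc + 1))) := mul_le_mul_of_nonneg_left hδcK hKc0
    have h4 : Kc * (cflat / (2 * (Kc + 1))) < cflat := by
      have hpos : 0 < 2 * (Kc + 1) := by positivity
      rw [mul_div_assoc', div_lt_iff₀ hpos]
      nlinarith
    linarith
  refine hV3 Λ lo hi hδ hδρ ext hext hK h𝓐₀ εr hε hερ6 reg' hreg' hcl hDreg' (δc := δc) (m := 8 * (((F.P Kt).d : ℝ) - 1) * δc * B₁ * M₂) hδc0 hδcr hnum fun Vk hVk => ?_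
  obtain ⟨U₀, hmin, hreg, hNF, hT1⟩ := hbase Vk hVk
  -- the slice action and the slice datum coordinates, DEFINED by their formulas
  let a : S → ℂ := fun X => ∑ p : Plaq (F.P Kt) 0, (1 - (expMulC (X : VecField (F.P Kt) 0 (EuclideanSpace ℂ (Fin 3))) (coeField U₀) ⟨p.src, p.μ⟩ *
        expMulC (X : VecField (F.P Kt) 0 (EuclideanSpace ℂ (Fin 3))) (coeField U₀) ⟨p.src.shift p.μ, p.ν⟩ *
        Matrix.adjugate (expMulC (X : VecField (F.P Kt) 0 (EuclideanSpace ℂ (Fin 3))) (coeField U₀) ⟨p.src.shift p.ν, p.μ⟩) *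
        Matrix.adjugate (expMulC (X : VecField (F.P Kt) 0 (EuclideanSpace ℂ (Fin 3))) (coeField U₀) ⟨p.src, p.ν⟩)).trace / 2)
  let Φ₀ : S → Fin (constrCard (Bj ν.M₁ Z k) k) → EuclideanSpace ℂ (Fin 3) := fun X i =>
    logCoordC (star ((avgFamily (Node00.avOfRecord F 2 Kt) (qsstarGIter0 k (ext Vk))
        ((constrEnum (Bj ν.M₁ Z k) k).symm i).1 ((constrEnum (Bj ν.M₁ Z k) k).symm i).2.1 : SU2) : Matrix (Fin 2) (Fin 2) ℂ) *
        iterMh ((constrEnum (Bj ν.M₁ Z k) k).symm i).1 (expMulC (X : VecField (F.P Kt) 0 (EuclideanSpace ℂ (Fin 3))) (coeField U₀)) ((constrEnum (Bj ν.M₁ Z k) k).symm i).2.1)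
  have ha : ∀ X : S, a X = ∑ p : Plaq (F.P Kt) 0, (1 - (expMulC (X : VecField (F.P Kt) 0 (EuclideanSpace ℂ (Fin 3))) (coeField U₀) ⟨p.src, p.μ⟩ *
        expMulC (X : VecField (F.P Kt) 0 (EuclideanSpace ℂ (Fin 3))) (coeField U₀) ⟨p.src.shift p.μ, p.ν⟩ *
        Matrix.adjugate (expMulC (X : VecField (F.P Kt) 0 (EuclideanSpace ℂ (Fin 3))) (coeField U₀) ⟨p.src.shift p.ν, p.μ⟩) *
        Matrix.adjugate (expMulC (X : VecField (F.P Kt) 0 (EuclideanSpace ℂ (Fin 3))) (coeField U₀) ⟨p.src, p.ν⟩)).trace / 2) := fun X => rfl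
  have hΦ₀ : ∀ (X : S) i, Φ₀ X i = logCoordC (star ((avgFamily (Node00.avOfRecord F 2 Kt) (qsstarGIter0 k (ext Vk))
        ((constrEnum (Bj ν.M₁ Z k) k).symm i).1 ((constrEnum (Bj ν.M₁ Z k) k).symm i).2.1 : SU2) : Matrix (Fin 2) (Fin 2) ℂ) *
        iterMh ((constrEnum (Bj ν.M₁ Z k) k).symm i).1 (expMulC (X : VecField (F.P Kt) 0 (EuclideanSpace ℂ (Fin 3))) (coeField U₀)) ((constrEnum (Bj ν.M₁ Z k) k).symm i).2.1) :=
    fun X i => rfl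
  -- [15] (45) in velocity currency, per base field from the class (dag-n12-w6 g11)
  have hH := hH_velocity_Bj_of_isMinimizer_class {ν with εreg := εr} Kt Z hkK hM4 hdiv hε hsbU hερ6 hHB hεH hmin hmin.2.1 S hroot hF1 hF3
  -- (M) per base field: dag-n12-w6's producer fed the height's (R2)
  have hcurv := hR2 εr hε hερ U₀ hmin.1 _ hmin.2.1 S Φ₀ hΦ₀
  have hMul := multiplierLetter_Bj_of_isMinimizer_class_of_curvatureLetter {ν with εreg := εr} Kt Z hk0 hkK hM4 hdiv hε hsbU hερ6 hHB hεH hB0 hmin hmin.2.1 S hroot hF1 hF3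
    hlen ha hΦ₀ hδc0 hNF hcurv
  refine ⟨U₀, a, Φ₀, hmin, hreg, ha, hΦ₀, hH, hNF, ?_, hT1⟩
  intro ℓ₀ hℓ₀ p hp hker
  have h := hMul ℓ₀ hℓ₀ p hp hker
  have hm : 8 * (((F.P Kt).d : ℝ) - 1) * δc * (Real.sqrt 2 * ((1 + 2 * (Fintype.card (PBond (F.P Kt) 0)) * Lp) * Real.sqrt (Fintype.card (PBond (F.P Kt) 0)) * B)) * M₂ =
      8 * (((F.P Kt).d : ℝ) - 1) * δc * B₁ * M₂ := by rw [hB₁]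
  rw [hm] at h
  exact h


/-! ## §3  The residual-gauge form, εreg-uniform -/

/-- ★★★ **V4u IN RESIDUAL-GAUGE FORM** — as `…_threshold_residual` (p722394 §3) with the threshold before the class tolerance: per base field the minimiser, the datum's regularity, a residual
`σ`, the (δ) row for `U₀^σ`, (T1@q₀) for `U₀`; §2 at `U₀^σ` (`isMinimizer_gaugeAct_of_residual` at `ν⟨εreg := εr⟩`, `thm1Row_gaugeAct_of_residual`).
[cite: Balaban1989LargeFieldII, (1.12)–(1.13) p.359; Balaban1989LargeFieldI, Prop. 1 p.194; Balaban1985Variational, Thm 1 p.279, (3)–(4) p.278, (181) p.307; Balaban1988Convergent, (2.10)–(2.13) pp.256–257] -/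
theorem hMin_atRecord_of_node00Letters_thm1AtBase_central_ofClass_threshold_residual_uniform (ν : Node00.Stage7Numerics) (Kt : ℕ) (hd : 2 ≤ (F.P Kt).d) (Z : Set (Site (F.P Kt) 0)) (𝔹 : DetSet (F.P Kt)) (h𝔹Z : 𝔹 = Bj ν.M₁ Z k) (hkK : k + 1 ≤ (F.P Kt).m + (F.P Kt).K)
    (hM4 : 4 * (F.P Kt).L ≤ ν.M₁) (hdiv : side (F.P Kt).L ν.M₁ k ∣ (F.P Kt).sitesPerDir 0) (hZblk : B14.Eq22Determines.IsBlockUnion k Z)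
    {ρ'' : ℝ} (hsbU : ∀ W : GaugeField (F.P Kt) 0 SU2, ‖coeField W - 1‖ ≤ ρ'' → SmallBelow (Node00.avOfRecord F 2 Kt) k W)
    (hρ : 0 < ρ'')
    (hk0 : 0 < k)
    -- ONCE per height: the right-inverse letter of the real chart (dag-n12-w6's `hHB`, inhabited by `N12HsurjOfClass.exists_hsurjLetters`)
    {εH B : ℝ}
    (hHB : ∀ (Wd : MSField (F.P Kt) SU2) (U₀ : GaugeField (F.P Kt) 0 SU2),
      AgreeOn (Bj ν.M₁ Z k) (avgFamily (avOfRecord F 2 Kt) U₀) Wd →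
      (∀ i' : Fin (constrCard (Bj ν.M₁ Z k) k), ∃ U' : GaugeField (F.P Kt) 0 SU2,
        (∀ b ∈ feeds (((constrEnum (Bj ν.M₁ Z k) k).symm i').1 : ℕ) ((constrEnum (Bj ν.M₁ Z k) k).symm i').2.1, U' b = U₀ b) ∧
          SmallBelow (avOfRecord F 2 Kt) k U') →
      (∀ (j : ℕ), 1 ≤ j → j ≤ k → ∀ y : Site (F.P Kt) j, embIter j y ∈ maxDomT ν.M₁ Z j → ∃ U' : GaugeField (F.P Kt) 0 SU2,
        (∀ c : PBond (F.P Kt) j, (c.src = y ∨ c.tgt = y) → ∀ b₀ : PBond (F.P Kt) 0,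
          (iterBlockOf j b₀.src = c.src ∨ iterBlockOf j b₀.src = c.tgt) → (iterBlockOf j b₀.tgt = c.src ∨ iterBlockOf j b₀.tgt = c.tgt) → U' b₀ = U₀ b₀) ∧
        SmallBelow (avOfRecord F 2 Kt) k U') →
      (∀ (j : ℕ), 1 ≤ j → j ≤ k → ∀ y : Site (F.P Kt) j, embIter j y ∈ maxDomT ν.M₁ Z j →
        PlaqSmallOn (boxPlaqs (fun κ => lift (F.P Kt) (embIter j y) κ - ((((F.P Kt).L ^ j : ℕ) : ℤ) + ((((F.P Kt).L ^ j - 1) / 2 : ℕ) : ℤ)))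
          (fun κ => lift (F.P Kt) (embIter j y) κ + ((((F.P Kt).L ^ j : ℕ) : ℤ) + ((((F.P Kt).L ^ j - 1) / 2 : ℕ) : ℤ))) : Set (Plaq (F.P Kt) 0)) εH U₀) →
      ∃ H : (Fin (constrCard (Bj ν.M₁ Z k) k) → lieSU (Fin 2)) → PBond (F.P Kt) 0 → lieSU (Fin 2),
        (∀ v, fderiv ℝ (msChart F 2 Kt k (Bj ν.M₁ Z k) Wd U₀) 0 (H v) = v) ∧ ∀ v, Real.sqrt (∑ b, ‖H v b‖ ^ 2) ≤ B * ‖v‖) (hB0 : 0 ≤ B)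
    -- ONE forest and its axial slice per instance (dag-n12-w3's `N12ForestSlice.exists_forest_slice_Bj`): (F1), (F2), (TREE), (F3)
    (path : Site (F.P Kt) 0 → List (LStep (F.P Kt) 0)) (S : Submodule ℂ (VecField (F.P Kt) 0 (EuclideanSpace ℂ (Fin 3))))
    (hF1 : ∀ x, ∀ s ∈ path x, ∃ x' x'' : Site (F.P Kt) 0, path x'' = path x' ++ [s] ∧
        (s.fwd = true → s.bond.src = x' ∧ s.bond.tgt = x'') ∧ (s.fwd = false → s.bond.src = x'' ∧ s.bond.tgt = x'))
    (hF2 : ∀ j, j ≤ k → ∀ c ∈ bondsOf (𝔹 j), path (embIter j c.src) = [] ∧ path (embIter j c.tgt) = [])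
    (hTREE : ∀ x : Site (F.P Kt) 0, x ∉ {z : Site (F.P Kt) 0 | ∃ j, j ≤ k ∧ ∃ c ∈ bondsOf (𝔹 j), (z = embIter j c.src ∨ z = embIter j c.tgt)} →
      ∃ (x' : Site (F.P Kt) 0) (s : LStep (F.P Kt) 0), path x = path x' ++ [s] ∧
        (s.fwd = true → s.bond.src = x' ∧ s.bond.tgt = x) ∧ (s.fwd = false → s.bond.src = x ∧ s.bond.tgt = x'))
    (hF3 : ∀ X : VecField (F.P Kt) 0 (EuclideanSpace ℂ (Fin 3)), X ∈ S ↔ ∀ x, ∀ s ∈ path x, X s.bond = 0) :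
    -- THE GAUGE-TOLERANCE THRESHOLD, announced before the base fields (it absorbs the flat coercivity `c♭` of (P♭Q), the (L) constant and radius, the preimage letter `B₁` and the chart curvature `M₂`)
    ∃ δ₀ : ℝ, 0 < δ₀ ∧
    -- THE WINDOW, THE DATUM's REGULARITY TOLERANCE, THE EXTENSION, THE COMPACT PARAMETER SET AND THE BOUND — ALL AFTER THE CONSTANTS
    ∀ (Λ : Set (Site (F.P Kt) k)) (lo hi : Fin (F.P Kt).d → ℤ) {δ : ℝ}, 0 < δ → 6 * ((((F.P Kt).d - 1 : ℕ)) : ℝ) * (F.P Kt).L ^ k * δ ≤ ρ'' →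
    ∀ (ext : GaugeField (F.P Kt) k SU2 → GaugeField (F.P Kt) k SU2), (∀ W, ext W = extend Λ (shellGauge W lo hi) W) →
    ∀ {K : Set (GaugeField (F.P Kt) k SU2)}, IsCompact K → ∀ {𝓐₀ : ℝ}, 1 < 𝓐₀ →
    -- THE CLASS TOLERANCE, ITS FLOORS AND THE CLASS FACTS, AFTER THE THRESHOLD (εreg-uniform edition: `ν⟨εreg := εr⟩`, `M₁` unchanged)
    ∀ (εr : ℝ), 0 ≤ εr → 12 * ((((F.P Kt).d - 1 : ℕ)) : ℝ) * (F.P Kt).L * εr ≤ ρ'' → εr ≤ εH →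
    ∀ (reg' : Set (GaugeField (F.P Kt) 0 SU2)), IsClosed reg' → closure (Node00.regMSCoPOfRecord F 2 {ν with εreg := εr} Kt k (maxDomT ν.M₁ Z)) ⊆ reg' →
      ContinuousOn (fun (U : GaugeField (F.P Kt) 0 SU2) (i : Fin (constrCard 𝔹 k)) =>
        ((avgFamily (Node00.avOfRecord F 2 Kt) U ((constrEnum 𝔹 k).symm i).1 ((constrEnum 𝔹 k).symm i).2.1 : SU2) : Matrix (Fin 2) (Fin 2) ℂ)) reg' →
    ∀ {δc : ℝ}, 0 ≤ δc → δc ≤ δ₀ →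
    (∀ Vk ∈ K, ∃ (U₀ : GaugeField (F.P Kt) 0 SU2) (σ : GaugeTransf (F.P Kt) 0 SU2),
      IsMinimizer (Node00.avOfRecord F 2 Kt) (Node00.regMSCoPOfRecord F 2 {ν with εreg := εr} Kt k (maxDomT ν.M₁ Z)) 𝔹
        (avgFamily (Node00.avOfRecord F 2 Kt) (qsstarGIter0 k (ext Vk))) U₀ ∧
      PlaqSmallOn (plaqsInside (pts k Z)) δ (ext Vk) ∧
      -- a RESIDUAL gauge `σ` (scale-`j` images `1` at both ends of every constrained bond — dag-n12-w3's (σ)_N producer's shape) …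
      (∀ j, j ≤ k → ∀ b ∈ bondsOf (𝔹 j), toMS σ j b.src = 1 ∧ toMS σ j b.tgt = 1) ∧
      -- … in which (δ) holds: `U₀^σ` bondwise `δc`-flat on the plaquettes meeting a bond sourced in `Ω₁(Z)`; the tower-flatness row (δ_T) and the multiplier row (M) of p717767 FOLLOW (`B15Prop1TowerFlatOfNearFlat`; dag-n12-w6's `…N12MultiplierLetterOfClass` + the lane's `…N12SliceDatumCurvatureOfClass`)
      (∀ q : Plaq (F.P Kt) 0, ((⟨q.src, q.μ⟩ : PBond (F.P Kt) 0) ∈ {b : PBond (F.P Kt) 0 | b.src ∈ maxDomT ν.M₁ Z 1} ∨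
          (⟨q.src.shift q.μ, q.ν⟩ : PBond (F.P Kt) 0) ∈ {b : PBond (F.P Kt) 0 | b.src ∈ maxDomT ν.M₁ Z 1} ∨
          (⟨q.src.shift q.ν, q.μ⟩ : PBond (F.P Kt) 0) ∈ {b : PBond (F.P Kt) 0 | b.src ∈ maxDomT ν.M₁ Z 1} ∨
          (⟨q.src, q.ν⟩ : PBond (F.P Kt) 0) ∈ {b : PBond (F.P Kt) 0 | b.src ∈ maxDomT ν.M₁ Z 1}) →
        ‖((gaugeAct σ U₀ ⟨q.src, q.μ⟩ : SU2) : Matrix (Fin 2) (Fin 2) ℂ) - 1‖ ≤ δc ∧ ‖((gaugeAct σ U₀ ⟨q.src.shift q.μ, q.ν⟩ : SU2) : Matrix (Fin 2) (Fin 2) ℂ) - 1‖ ≤ δc ∧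
          ‖((gaugeAct σ U₀ ⟨q.src.shift q.ν, q.μ⟩ : SU2) : Matrix (Fin 2) (Fin 2) ℂ) - 1‖ ≤ δc ∧ ‖((gaugeAct σ U₀ ⟨q.src, q.ν⟩ : SU2) : Matrix (Fin 2) (Fin 2) ℂ) - 1‖ ≤ δc) ∧
      -- (T1@q₀) — the capstone's row verbatim
      (∀ U ∈ reg', AgreeOn 𝔹 (avgFamily (Node00.avOfRecord F 2 Kt) U) (avgFamily (Node00.avOfRecord F 2 Kt) (qsstarGIter0 k (ext Vk))) →
        wilsonAction4 U ≤ wilsonAction4 U₀ →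
          ∃ u : GaugeTransf (F.P Kt) 0 SU2, (∀ j, j ≤ k → ∀ b ∈ bondsOf (𝔹 j), toMS u j b.src = toMS u j b.tgt ∧ ∀ g : SU2, toMS u j b.src * g = g * toMS u j b.src) ∧ gaugeAct u U = U₀)) →
    ∃ R : ℝ, 0 < R ∧ ∀ Vk ∈ K,
      ∃ Ũ : VecField (F.P Kt) k (EuclideanSpace ℂ (Fin 3)) × VecField (F.P Kt) k (EuclideanSpace ℂ (Fin 3)) → PBond (F.P Kt) 0 → Matrix (Fin 2) (Fin 2) ℂ,
        (∀ b i j, DifferentiableOn ℂ (fun z => Ũ z b i j) (ball 0 R)) ∧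
        (∀ z ∈ ball (0 : VecField (F.P Kt) k (EuclideanSpace ℂ (Fin 3)) × VecField (F.P Kt) k (EuclideanSpace ℂ (Fin 3))) R, ∀ b i j, ‖Ũ z b i j‖ ≤ 𝓐₀) ∧
        ∀ p B' : VecField (F.P Kt) k E3, ‖p‖ < R → ‖B'‖ < R → ∃ U' : GaugeField (F.P Kt) 0 SU2,
          (∀ b, Ũ (cplxVec p, cplxVec B') b = ((U' b : SU2) : Matrix (Fin 2) (Fin 2) ℂ)) ∧
            IsMinimizer (Node00.avOfRecord F 2 Kt) (Node00.regMSCoPOfRecord F 2 {ν with εreg := εr} Kt k (maxDomT ν.M₁ Z)) 𝔹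
              (avgFamily (Node00.avOfRecord F 2 Kt) (qsstarGIter0 k (expMul su2Chart B' (ext (expMul su2Chart p Vk))))) U' := by
  obtain ⟨δ₀, hδ₀, h⟩ := hMin_atRecord_of_node00Letters_thm1AtBase_central_ofClass_threshold_uniform ν Kt hd Z 𝔹 h𝔹Z hkK hM4 hdiv hZblk hsbU hρ
    hk0 hHB hB0 path S hF1 hF2 hTREE hF3
  refine ⟨δ₀, hδ₀, fun Λ lo hi {δ} hδ hδρ ext hext {K} hK {𝓐₀} h𝓐₀ εr hε hερ hεH reg' hreg' hcl hDreg' {δc} hδc0 hδcδ hbase =>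
    h Λ lo hi hδ hδρ ext hext hK h𝓐₀ εr hε hερ hεH reg' hreg' hcl hDreg' hδc0 hδcδ fun Vk hVk => ?_⟩
  obtain ⟨U₀, σ, hmin, hreg, hσ, hNF, hT1⟩ := hbase Vk hVk
  subst h𝔹Z
  have hk : k ≤ (F.P Kt).m + (F.P Kt).K := Nat.le_of_succ_le hkK
  exact ⟨gaugeAct σ U₀,
    isMinimizer_gaugeAct_of_residual (Node00.avOfRecord F 2 Kt) (Bj ν.M₁ Z k) hk (fun _ hj => Bj_of_gt hj) hσ
      (fun U hU => gaugeAct_mem_regMSCoPOfRecord {ν with εreg := εr} Kt k (maxDomT ν.M₁ Z) σ U hU) hmin,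
    hreg, hNF, thm1Row_gaugeAct_of_residual (Node00.avOfRecord F 2 Kt) reg' (Bj ν.M₁ Z k) k _ hσ hT1⟩

end Summit.QuantumFields.YangMills.BalabanUVNodes.N12MinimiserFamilyOfClassThresholdUniform

end
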